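import Summits.ResolutionOfSingularities.ResolutionOfSingularities.Theorems.HomologicalConductorNoZenoCaOneCubeZero
import Mathlib.Algebra.Ring.MinimalAxioms
import HarnessLib

/-!
# Crux `NoZenoR` (stmt-ResolutionOfSingularities-19943), T_ST — the explicit ring `k[x,y]/(x,y)³`: `ca¹ = 𝔪² ≠ 𝔪`

Route `ResolutionOfSingularities/HomologicalConductor`, chain W4.4, KERNEL-g22 THEOREM 22.2 (a) (lead g22). `[OURS]` — AI-formalised, weaker than
expert review; NOT a statement of any manuscript under review.

We realise `R = k[x,y]/(x,y)³` by structure constants: `CubeZero k` is the `k`-algebra with basis `1, x, y, x², xy, y²` (an element is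
`a + u x + v y + p x² + q xy + r y²`) and the truncated polynomial multiplication. We prove it is a commutative local ring with maximal ideal
`𝔪 = {a = 0}`, `𝔪² = {a = u = v = 0}`, `𝔪³ = 0`, `ann(x), ann(y) ⊆ 𝔪²`, `((x) + 𝔪²) ∩ ((y) + 𝔪²) ⊆ 𝔪²`, and conclude from
`…NoZenoCaOneCubeZero.cohomologyAnnihilatorOfDegree_one_eq_maximalIdeal_sq`:

  `cohomologyAnnihilatorOfDegree (CubeZero k) 1 = 𝔪²` and in particular `y ∉ ca¹` although `y ∈ 𝔪` (`caOne_ne_maximalIdeal`).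

This is the kernel-certified first half of KERNEL-g22 THEOREM 22.2 (the dimension-zero counterexample to «ca = ca^{dim+1}»: the second half,
`ca²(R) = 𝔪`, is a hand theorem, KERNEL-g22 §2 (b) / ST-NOTE §2).
-/

noncomputable section

-- single-problem summit: the doubled namespace component is forced
set_option linter.dupNamespace false

open Literature.RingTheory.CohomologyAnnihilator

universe u

namespace Summit.ResolutionOfSingularities.ResolutionOfSingularities.Theorems.NoZeno.CubeZeroRing

/-- The `k`-algebra `k[x,y]/(x,y)³` by structure constants: `⟨a,u,v,p,q,r⟩ = a + u x + v y + p x² + q xy + r y²`. [this work] -/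
@[ext]
structure CubeZero (k : Type u) where
  /-- constant coefficient -/
  a : k
  /-- coefficient of `x` -/
  u : k
  /-- coefficient of `y` -/
  v : k
  /-- coefficient of `x²` -/
  p : k
  /-- coefficient of `xy` -/
  q : k
  /-- coefficient of `y²` -/
  r : k

namespace CubeZero

variable {k : Type u} [Field k]

/-- Componentwise addition. [this work] -/
instance : Add (CubeZero k) := ⟨fun s t => ⟨s.a + t.a, s.u + t.u, s.v + t.v, s.p + t.p, s.q + t.q, s.r + t.r⟩⟩
/-- Zero. [this work] -/
instance : Zero (CubeZero k) := ⟨⟨0, 0, 0, 0, 0, 0⟩⟩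
/-- Componentwise negation. [this work] -/
instance : Neg (CubeZero k) := ⟨fun s => ⟨-s.a, -s.u, -s.v, -s.p, -s.q, -s.r⟩⟩
/-- One. [this work] -/
instance : One (CubeZero k) := ⟨⟨1, 0, 0, 0, 0, 0⟩⟩
/-- Truncated polynomial multiplication (`x³ = x²y = xy² = y³ = 0`). [this work] -/
instance : Mul (CubeZero k) := ⟨fun s t => ⟨s.a * t.a, s.a * t.u + s.u * t.a, s.a * t.v + s.v * t.a,
  s.a * t.p + s.p * t.a + s.u * t.u, s.a * t.q + s.q * t.a + s.u * t.v + s.v * t.u, s.a * t.r + s.r * t.a + s.v * t.v⟩⟩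

/-- Component formula `add_a`. [this work] -/
@[simp] theorem add_a (s t : CubeZero k) : (s + t).a = s.a + t.a := rfl
/-- Component formula `add_u`. [this work] -/
@[simp] theorem add_u (s t : CubeZero k) : (s + t).u = s.u + t.u := rfl
/-- Component formula `add_v`. [this work] -/
@[simp] theorem add_v (s t : CubeZero k) : (s + t).v = s.v + t.v := rfl
/-- Component formula `add_p`. [this work] -/
@[simp] theorem add_p (s t : CubeZero k) : (s + t).p = s.p + t.p := rfl
/-- Component formula `add_q`. [this work] -/
@[simp] theorem add_q (s t : CubeZero k) : (s + t).q = s.q + t.q := rfl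
/-- Component formula `add_r`. [this work] -/
@[simp] theorem add_r (s t : CubeZero k) : (s + t).r = s.r + t.r := rfl
/-- Component formula `zero_a`. [this work] -/
@[simp] theorem zero_a : (0 : CubeZero k).a = 0 := rfl
/-- Component formula `zero_u`. [this work] -/
@[simp] theorem zero_u : (0 : CubeZero k).u = 0 := rfl
/-- Component formula `zero_v`. [this work] -/
@[simp] theorem zero_v : (0 : CubeZero k).v = 0 := rfl
/-- Component formula `zero_p`. [this work] -/
@[simp] theorem zero_p : (0 : CubeZero k).p = 0 := rfl
/-- Component formula `zero_q`. [this work] -/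
@[simp] theorem zero_q : (0 : CubeZero k).q = 0 := rfl
/-- Component formula `zero_r`. [this work] -/
@[simp] theorem zero_r : (0 : CubeZero k).r = 0 := rfl
/-- Component formula `neg_a`. [this work] -/
@[simp] theorem neg_a (s : CubeZero k) : (-s).a = -s.a := rfl
/-- Component formula `neg_u`. [this work] -/
@[simp] theorem neg_u (s : CubeZero k) : (-s).u = -s.u := rfl
/-- Component formula `neg_v`. [this work] -/
@[simp] theorem neg_v (s : CubeZero k) : (-s).v = -s.v := rfl
/-- Component formula `neg_p`. [this work] -/
@[simp] theorem neg_p (s : CubeZero k) : (-s).p = -s.p := rfl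
/-- Component formula `neg_q`. [this work] -/
@[simp] theorem neg_q (s : CubeZero k) : (-s).q = -s.q := rfl
/-- Component formula `neg_r`. [this work] -/
@[simp] theorem neg_r (s : CubeZero k) : (-s).r = -s.r := rfl
/-- Component formula `one_a`. [this work] -/
@[simp] theorem one_a : (1 : CubeZero k).a = 1 := rfl
/-- Component formula `one_u`. [this work] -/
@[simp] theorem one_u : (1 : CubeZero k).u = 0 := rfl
/-- Component formula `one_v`. [this work] -/
@[simp] theorem one_v : (1 : CubeZero k).v = 0 := rfl
/-- Component formula `one_p`. [this work] -/
@[simp] theorem one_p : (1 : CubeZero k).p = 0 := rfl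
/-- Component formula `one_q`. [this work] -/
@[simp] theorem one_q : (1 : CubeZero k).q = 0 := rfl
/-- Component formula `one_r`. [this work] -/
@[simp] theorem one_r : (1 : CubeZero k).r = 0 := rfl
/-- Component formula `mul_a`. [this work] -/
@[simp] theorem mul_a (s t : CubeZero k) : (s * t).a = s.a * t.a := rfl
/-- Component formula `mul_u`. [this work] -/
@[simp] theorem mul_u (s t : CubeZero k) : (s * t).u = s.a * t.u + s.u * t.a := rfl
/-- Component formula `mul_v`. [this work] -/
@[simp] theorem mul_v (s t : CubeZero k) : (s * t).v = s.a * t.v + s.v * t.a := rfl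
/-- Component formula `mul_p`. [this work] -/
@[simp] theorem mul_p (s t : CubeZero k) : (s * t).p = s.a * t.p + s.p * t.a + s.u * t.u := rfl
/-- Component formula `mul_q`. [this work] -/
@[simp] theorem mul_q (s t : CubeZero k) : (s * t).q = s.a * t.q + s.q * t.a + s.u * t.v + s.v * t.u := rfl
/-- Component formula `mul_r`. [this work] -/
@[simp] theorem mul_r (s t : CubeZero k) : (s * t).r = s.a * t.r + s.r * t.a + s.v * t.v := rfl

/-- `CubeZero k` is a commutative ring (truncated polynomial multiplication). [this work] -/
instance instCommRing : CommRing (CubeZero k) :=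
  CommRing.ofMinimalAxioms
    (fun s t w => by ext <;> simp <;> ring)
    (fun s => by ext <;> simp)
    (fun s => by ext <;> simp)
    (fun s t w => by ext <;> simp <;> ring)
    (fun s t => by ext <;> simp <;> ring)
    (fun s => by ext <;> simp)
    (fun s t w => by ext <;> simp <;> ring)

/-- `0 ≠ 1`. [this work] -/
instance instNontrivial : Nontrivial (CubeZero k) :=
  ⟨⟨0, 1, fun h => by simpa using congrArg CubeZero.a h⟩⟩

/-- The element `x`. [this work] -/
def X : CubeZero k := ⟨0, 1, 0, 0, 0, 0⟩
/-- The element `y`. [this work] -/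
def Y : CubeZero k := ⟨0, 0, 1, 0, 0, 0⟩

/-- Component formula `X_a`. [this work] -/
@[simp] theorem X_a : (X : CubeZero k).a = 0 := rfl
/-- Component formula `X_u`. [this work] -/
@[simp] theorem X_u : (X : CubeZero k).u = 1 := rfl
/-- Component formula `X_v`. [this work] -/
@[simp] theorem X_v : (X : CubeZero k).v = 0 := rfl
/-- Component formula `X_p`. [this work] -/
@[simp] theorem X_p : (X : CubeZero k).p = 0 := rfl
/-- Component formula `X_q`. [this work] -/
@[simp] theorem X_q : (X : CubeZero k).q = 0 := rfl
/-- Component formula `X_r`. [this work] -/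
@[simp] theorem X_r : (X : CubeZero k).r = 0 := rfl
/-- Component formula `Y_a`. [this work] -/
@[simp] theorem Y_a : (Y : CubeZero k).a = 0 := rfl
/-- Component formula `Y_u`. [this work] -/
@[simp] theorem Y_u : (Y : CubeZero k).u = 0 := rfl
/-- Component formula `Y_v`. [this work] -/
@[simp] theorem Y_v : (Y : CubeZero k).v = 1 := rfl
/-- Component formula `Y_p`. [this work] -/
@[simp] theorem Y_p : (Y : CubeZero k).p = 0 := rfl
/-- Component formula `Y_q`. [this work] -/
@[simp] theorem Y_q : (Y : CubeZero k).q = 0 := rfl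
/-- Component formula `Y_r`. [this work] -/
@[simp] theorem Y_r : (Y : CubeZero k).r = 0 := rfl

/-- An element with invertible constant term is a unit: `(a + N)⁻¹ = a⁻¹ − a⁻²N + a⁻³N²` (`N³ = 0`). [this work] -/
theorem isUnit_of_a_ne_zero {s : CubeZero k} (hs : s.a ≠ 0) : IsUnit s := by
  set t : CubeZero k :=
    ⟨s.a⁻¹, -(s.a⁻¹ ^ 2) * s.u, -(s.a⁻¹ ^ 2) * s.v, -(s.a⁻¹ ^ 2) * s.p + s.a⁻¹ ^ 3 * s.u ^ 2,
      -(s.a⁻¹ ^ 2) * s.q + 2 * s.a⁻¹ ^ 3 * s.u * s.v, -(s.a⁻¹ ^ 2) * s.r + s.a⁻¹ ^ 3 * s.v ^ 2⟩ with ht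
  have hst : s * t = 1 := by
    ext
    · simp [ht]; field_simp
    · simp [ht]; field_simp; ring
    · simp [ht]; field_simp; ring
    · simp [ht]; field_simp; ring
    · simp [ht]; field_simp; ring
    · simp [ht]; field_simp; ring
  exact ⟨⟨s, t, hst, by rw [mul_comm]; exact hst⟩, rfl⟩

/-- An element with zero constant term is not a unit. [this work] -/
theorem not_isUnit_of_a_eq_zero {s : CubeZero k} (hs : s.a = 0) : ¬ IsUnit s := by
  rintro ⟨w, hw⟩
  have h := congrArg CubeZero.a w.mul_inv
  rw [mul_a] at h
  have : (w : CubeZero k).a = s.a := by rw [hw]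
  rw [this, hs, zero_mul] at h
  exact zero_ne_one h

/-- `CubeZero k` is local: an element is a unit iff its constant term is non-zero. [this work] -/
instance instIsLocalRing : IsLocalRing (CubeZero k) :=
  IsLocalRing.of_isUnit_or_isUnit_one_sub_self fun s => by
    by_cases hs : s.a = 0
    · right
      apply isUnit_of_a_ne_zero
      rw [sub_eq_add_neg, add_a, neg_a, one_a, hs, neg_zero, add_zero]
      exact one_ne_zero
    · left
      exact isUnit_of_a_ne_zero hs

/-- The maximal ideal is `{a = 0}`. [this work] -/
theorem mem_maximalIdeal_iff {s : CubeZero k} : s ∈ IsLocalRing.maximalIdeal (CubeZero k) ↔ s.a = 0 := by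
  rw [IsLocalRing.mem_maximalIdeal, mem_nonunits_iff]
  constructor
  · intro h
    by_contra hs
    exact h (isUnit_of_a_ne_zero hs)
  · exact not_isUnit_of_a_eq_zero

/-- The ideal `{a = u = v = 0}` (= `𝔪²`, see below). [this work] -/
def K2 : Ideal (CubeZero k) where
  carrier := {s | s.a = 0 ∧ s.u = 0 ∧ s.v = 0}
  add_mem' := by
    rintro s t ⟨h1, h2, h3⟩ ⟨h4, h5, h6⟩
    exact ⟨by simp [h1, h4], by simp [h2, h5], by simp [h3, h6]⟩
  zero_mem' := ⟨rfl, rfl, rfl⟩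
  smul_mem' := by
    rintro w s ⟨h1, h2, h3⟩
    refine ⟨?_, ?_, ?_⟩ <;> simp [smul_eq_mul, h1, h2, h3]

/-- Membership in `K2`. [this work] -/
theorem mem_K2_iff {s : CubeZero k} : s ∈ (K2 : Ideal (CubeZero k)) ↔ s.a = 0 ∧ s.u = 0 ∧ s.v = 0 := Iff.rfl

/-- The constant element `c · 1`. [this work] -/
def C (c : k) : CubeZero k := ⟨c, 0, 0, 0, 0, 0⟩

/-- Component formula `C_a`. [this work] -/
@[simp] theorem C_a (c : k) : (C c).a = c := rfl
/-- Component formula `C_u`. [this work] -/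
@[simp] theorem C_u (c : k) : (C c).u = 0 := rfl
/-- Component formula `C_v`. [this work] -/
@[simp] theorem C_v (c : k) : (C c).v = 0 := rfl
/-- Component formula `C_p`. [this work] -/
@[simp] theorem C_p (c : k) : (C c).p = 0 := rfl
/-- Component formula `C_q`. [this work] -/
@[simp] theorem C_q (c : k) : (C c).q = 0 := rfl
/-- Component formula `C_r`. [this work] -/
@[simp] theorem C_r (c : k) : (C c).r = 0 := rfl

/-- `𝔪² = {a = u = v = 0}`. [this work] -/
theorem maximalIdeal_sq_eq_K2 : IsLocalRing.maximalIdeal (CubeZero k) ^ 2 = K2 := by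
  apply le_antisymm
  · rw [pow_two, Ideal.mul_le]
    intro s hs t ht
    rw [mem_maximalIdeal_iff] at hs ht
    exact ⟨by simp [hs], by simp [hs, ht], by simp [hs, ht]⟩
  · rintro s ⟨h1, h2, h3⟩
    have hX : (X : CubeZero k) ∈ IsLocalRing.maximalIdeal (CubeZero k) := mem_maximalIdeal_iff.mpr rfl
    have hY : (Y : CubeZero k) ∈ IsLocalRing.maximalIdeal (CubeZero k) := mem_maximalIdeal_iff.mpr rfl
    have hs : s = C s.p * (X * X) + C s.q * (X * Y) + C s.r * (Y * Y) := by
      ext <;> simp [h1, h2, h3]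
    rw [hs, pow_two]
    refine Ideal.add_mem _ (Ideal.add_mem _ ?_ ?_) ?_ <;>
      exact Ideal.mul_mem_left _ _ (Ideal.mul_mem_mul ‹_› ‹_›)

/-- `𝔪³ = 0`. [this work] -/
theorem maximalIdeal_cube_eq_bot : IsLocalRing.maximalIdeal (CubeZero k) ^ 3 = ⊥ := by
  rw [pow_succ, maximalIdeal_sq_eq_K2, eq_bot_iff, Ideal.mul_le]
  rintro s ⟨h1, h2, h3⟩ t ht
  rw [mem_maximalIdeal_iff] at ht
  rw [Ideal.mem_bot]
  ext <;> simp [h1, h2, h3, ht]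

/-- `ann(x) ⊆ 𝔪²`. [this work] -/
theorem annihilator_span_X_le : (Ideal.span {(X : CubeZero k)}).annihilator ≤ IsLocalRing.maximalIdeal (CubeZero k) ^ 2 := by
  intro s hs
  rw [Submodule.mem_annihilator] at hs
  have h := hs X (Ideal.subset_span rfl)
  rw [smul_eq_mul] at h
  have ha := congrArg CubeZero.u h
  have hu := congrArg CubeZero.p h
  have hv := congrArg CubeZero.q h
  simp at ha hu hv
  rw [maximalIdeal_sq_eq_K2]
  exact ⟨ha, by simpa [ha] using hu, by simpa [ha] using hv⟩

/-- `ann(y) ⊆ 𝔪²`. [this work] -/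
theorem annihilator_span_Y_le : (Ideal.span {(Y : CubeZero k)}).annihilator ≤ IsLocalRing.maximalIdeal (CubeZero k) ^ 2 := by
  intro s hs
  rw [Submodule.mem_annihilator] at hs
  have h := hs Y (Ideal.subset_span rfl)
  rw [smul_eq_mul] at h
  have ha := congrArg CubeZero.v h
  have hu := congrArg CubeZero.q h
  have hv := congrArg CubeZero.r h
  simp at ha hu hv
  rw [maximalIdeal_sq_eq_K2]
  exact ⟨ha, by simpa [ha] using hu, by simpa [ha] using hv⟩

/-- `((x) + 𝔪²) ∩ ((y) + 𝔪²) ⊆ 𝔪²`. [this work] -/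
theorem span_X_sup_inf_span_Y_sup_le :
    (Ideal.span {(X : CubeZero k)} ⊔ IsLocalRing.maximalIdeal (CubeZero k) ^ 2) ⊓
      (Ideal.span {(Y : CubeZero k)} ⊔ IsLocalRing.maximalIdeal (CubeZero k) ^ 2) ≤
      IsLocalRing.maximalIdeal (CubeZero k) ^ 2 := by
  -- `(x) + 𝔪² ⊆ {a = v = 0}` and `(y) + 𝔪² ⊆ {a = u = 0}`
  let JX : Ideal (CubeZero k) :=
    { carrier := {s | s.a = 0 ∧ s.v = 0}
      add_mem' := by rintro s t ⟨h1, h2⟩ ⟨h3, h4⟩; exact ⟨by simp [h1, h3], by simp [h2, h4]⟩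
      zero_mem' := ⟨rfl, rfl⟩
      smul_mem' := by rintro w s ⟨h1, h2⟩; exact ⟨by simp [smul_eq_mul, h1], by simp [smul_eq_mul, h1, h2]⟩ }
  let JY : Ideal (CubeZero k) :=
    { carrier := {s | s.a = 0 ∧ s.u = 0}
      add_mem' := by rintro s t ⟨h1, h2⟩ ⟨h3, h4⟩; exact ⟨by simp [h1, h3], by simp [h2, h4]⟩
      zero_mem' := ⟨rfl, rfl⟩
      smul_mem' := by rintro w s ⟨h1, h2⟩; exact ⟨by simp [smul_eq_mul, h1], by simp [smul_eq_mul, h1, h2]⟩ }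
  have hX : Ideal.span {(X : CubeZero k)} ⊔ IsLocalRing.maximalIdeal (CubeZero k) ^ 2 ≤ JX := by
    refine sup_le ?_ ?_
    · rw [Ideal.span_le, Set.singleton_subset_iff]; exact ⟨rfl, rfl⟩
    · rw [maximalIdeal_sq_eq_K2]; rintro s ⟨h1, _, h3⟩; exact ⟨h1, h3⟩
  have hY : Ideal.span {(Y : CubeZero k)} ⊔ IsLocalRing.maximalIdeal (CubeZero k) ^ 2 ≤ JY := by
    refine sup_le ?_ ?_
    · rw [Ideal.span_le, Set.singleton_subset_iff]; exact ⟨rfl, rfl⟩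
    · rw [maximalIdeal_sq_eq_K2]; rintro s ⟨h1, h2, _⟩; exact ⟨h1, h2⟩
  intro s hs
  obtain ⟨h1, h2⟩ := hX hs.1
  obtain ⟨_, h4⟩ := hY hs.2
  rw [maximalIdeal_sq_eq_K2]
  exact ⟨h1, h4, h2⟩

/-- **`ca¹(k[x,y]/(x,y)³) = 𝔪²`.** [this work; KERNEL-g22 THEOREM 22.2 (a)] -/
theorem cohomologyAnnihilatorOfDegree_one_eq :
    cohomologyAnnihilatorOfDegree (CubeZero k) 1 = IsLocalRing.maximalIdeal (CubeZero k) ^ 2 :=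
  CaOneCubeZero.cohomologyAnnihilatorOfDegree_one_eq_maximalIdeal_sq maximalIdeal_cube_eq_bot
    annihilator_span_X_le annihilator_span_Y_le span_X_sup_inf_span_Y_sup_le

/-- Hence `y ∈ 𝔪 ∖ ca¹`: the first cohomology annihilator of the (non-Gorenstein, artinian) local ring `k[x,y]/(x,y)³` is NOT the maximal
ideal (whereas `ca = ca² = 𝔪` by KERNEL-g22 §2 (b), a hand theorem). [this work; KERNEL-g22 THEOREM 22.2] -/
theorem Y_mem_maximalIdeal_and_not_mem_caOne :
    (Y : CubeZero k) ∈ IsLocalRing.maximalIdeal (CubeZero k) ∧ (Y : CubeZero k) ∉ cohomologyAnnihilatorOfDegree (CubeZero k) 1 := by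
  refine ⟨mem_maximalIdeal_iff.mpr rfl, fun h => ?_⟩
  rw [cohomologyAnnihilatorOfDegree_one_eq, maximalIdeal_sq_eq_K2] at h
  exact one_ne_zero h.2.2

/-- `ca¹(k[x,y]/(x,y)³) ≠ 𝔪`. [this work; KERNEL-g22 THEOREM 22.2] -/
theorem caOne_ne_maximalIdeal :
    cohomologyAnnihilatorOfDegree (CubeZero k) 1 ≠ IsLocalRing.maximalIdeal (CubeZero k) := fun h =>
  Y_mem_maximalIdeal_and_not_mem_caOne.2 (h ▸ Y_mem_maximalIdeal_and_not_mem_caOne.1)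

end CubeZero

end Summit.ResolutionOfSingularities.ResolutionOfSingularities.Theorems.NoZeno.CubeZeroRing
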